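import Summits.HodgeConjecture.CorCM.GaloisCertificateSplitExtension
import HarnessLib

/-!
# BAD is monotone along EVERY extension of degree `≥ 3`: a certificate for a quotient `Q = G/N` (`|N| ≥ 3`) lifts to `G`,
# split or not — one point per fibre over `T₀`, all but one point per fibre over its complement

COR-CM (cell `pub-hodgecm2`), binder seat b04 (gen 31), count-neutral own lane «Galois-CM-type classification»; supersedes the
SPLIT hypothesis of `CorCM/GaloisCertificateSplitExtension` (same session).  KERNEL ONLY: theorems; no definition, no named
fact, no `sorry`.  `HC_CM` is neither used nor claimed.

THE SETTING.  `f : G →* Q` a SURJECTIVE homomorphism of finite groups with two distinct non-trivial elements `n₁, n₂ ∈ ker f`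
(`|ker f| ≥ 3`), `c ∈ G` with `c² = 1` and `c₀ = f c`, and an ANNIHILATOR CERTIFICATE `(T₀, b₀)` for `(Q, c₀)` (gen 24 format:
`T₀` a CM set for `c₀` with trivial left stabiliser, `b₀ : Q → ℤ` non-zero, `c₀`-antisymmetric, annihilated by all right
translates of `T₀`).  NO complement, NO action, NO hypothesis on `ker f` beyond `|ker f| ≥ 3`.

THE LIFT (§1–§2).  Fix any set-theoretic section `s` of `f` (`f (s q) = q`).  Put
  `S = {x : f x ∈ T₀, x = s(f x)} ⊔ {x : f x ∉ T₀, x ≠ c · s(c₀ f x)}`,   `b = b₀ ∘ f`.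
So `S` has exactly ONE point in each fibre over `T₀` and all but one point in each fibre over `Q ∖ T₀ = c₀ T₀` — and the
missing point over `c₀ q` is `c` times the chosen point over `q`, which makes `S` a CM set for `c` (`mem_liftQ_cm`).  The PULLED
BACK weight `b₀ ∘ f` is annihilated (`liftQ_annihilated`): grouping `Σ_{x ∈ S} b₀(f x · f g)` by fibres gives
`Σ_{q ∈ T₀} b₀(q r) + (|N| − 1) Σ_{q ∉ T₀} b₀(q r) = 0 + 0` (`r = f g`; all fibres have `|N|` elements, `card_fiber_eq`; an
antisymmetric weight sums to zero over `Q`, hence over `Q ∖ T₀`).  The left stabiliser is trivial (`liftQ_leftStabiliser`): an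
element `v ∈ ker f ∖ 1` moves the single point of a fibre over `T₀` off itself inside the fibre; an element with `f v ≠ 1` has a
`q` with `q ∈ T₀ ↮ f(v) q ∈ T₀` (primitivity of `T₀`), and `v` maps the `|N| − 1 ≥ 2` non-points (resp. points) of the fibre over
`q` injectively into a fibre containing only ONE non-point (resp. point) — here `|ker f| ≥ 3` is used.
**`exists_liftQ_certificate`**: the certificate `(S, b₀ ∘ f)` for `(G, c)`.

THE THEOREM (§3, **`exists_simple_degenerate_of_quotient_certificate`**).  `K` Galois CM, `e : Gal(K/ℚ) ≃* G₀`, `f : G₀ →* Q₀`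
surjective with `|ker f| ≥ 3`, and an annihilator certificate for `(Q₀, f(e c))` ⟹ `K` carries a SIMPLE DEGENERATE abelian
variety of dimension `|G₀|/2` with CM by `K` (rational `(p,p)` class outside the divisor ring on some power).  Field form
(`CorCM/GaloisDegenerateExtension`): **for Galois CM fields `K ⊇ K₀` with `[K : K₀] ≥ 3`, BAD(K₀) ⟹ BAD(K)** — equivalently
GOOD(K) ⟹ GOOD(K₀), GOOD meaning that every primitive CM type is nondegenerate, i.e. that the Hodge ring of every power of every
simple CM abelian variety with CM by the field is generated by divisor classes (`B = D`, which implies the Hodge conjecture for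
them), BAD that some such power carries a Hodge class outside the divisor ring (an exceptional class, whose algebraicity is the
open question — BAD does not refute the Hodge conjecture).  NEW BAD GROUPS (non-split over a BAD quotient, previously «arithmetic
residue»): `C_{p^k} ⋊ C₈` for every `k ≥ 1` and every `p` with `C_p ⋊ C₈` BAD (`p = 3, 7, 11, 17, 19, 23, 31, 41, 43, 71, 73,
89, 127`: gens 25–29), `Q₈ × C_{p^k}` likewise, every `G` with a normal subgroup `N ∌ c`, `|N| ≥ 3`, `G/N` BAD.  Seat numerics
`scratch/nonsplit.py`: `C₉ ⋊ C₈` over `C₃ ⋊ C₈` — rank `33 < 37`, primitive.  The degree-`2` case (`|ker f| = 2`) is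
`CorCM/GaloisCertificateSplitTwo` (split, `Q` not of exponent `2`); whether BAD always ascends along quadratic extensions is open.

## References

* [Kubota1965] T. Kubota, *On the field extension by complex multiplication*, Trans. AMS 118 (1965), §2, §4 Lemma 2.
* [Shimura1998] G. Shimura, *Abelian Varieties with Complex Multiplication and Modular Functions*, §6.2 Thm. 3, §8.2 Prop. 26,
  §18.2 Lemma (i).
* [Gordon1999HodgeAVSurvey] B. B. Gordon, *A survey of the Hodge conjecture for abelian varieties*, Thm. 6.4, §9.3.
-/

noncomputable section

open CategoryTheory CategoryTheory.Limits NumberField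
open scoped BigOperators

namespace Summit.HodgeConjecture.CorCM.GaloisModels

open Literature.NumberTheory.ComplexMultiplication
open Literature.AlgebraicGeometry.Motives (AbelianVariety CMType)
open Literature.AlgebraicGeometry.HodgeTheory
open Literature.AlgebraicGeometry.ComplexMultiplication (IsCMTypeRealisation)
open Literature.AlgebraicGeometry.Pohlmann1968
open Literature.Barriers.HodgeConjecture (divisorClassesSpan)

namespace QuotientLift

section Model

variable {G Q : Type*} [Group G] [Group Q] [Fintype G] [DecidableEq G] [DecidableEq Q]
variable {f : G →* Q} {s : Q → G}

/-! ## §1 Fibres of a surjective homomorphism with a set-theoretic section `s` -/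

/-- The fibre over `q` is `s(q) · ker f`. [folklore] -/
theorem fiber_eq_image (hs : ∀ q, f (s q) = q) (q : Q) :
    (Finset.univ.filter fun x : G => f x = q) = (Finset.univ.filter fun n : G => f n = 1).image fun n => s q * n := by
  ext x
  simp only [Finset.mem_filter, Finset.mem_univ, true_and, Finset.mem_image]
  constructor
  · intro hx
    exact ⟨(s q)⁻¹ * x, by rw [map_mul, map_inv, hs, hx, inv_mul_cancel], mul_inv_cancel_left _ _⟩
  · rintro ⟨n, hn, rfl⟩
    rw [map_mul, hs, hn, mul_one]

/-- All fibres have `|ker f|` elements. [folklore] -/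
theorem card_fiber_eq (hs : ∀ q, f (s q) = q) (q : Q) :
    (Finset.univ.filter fun x : G => f x = q).card = (Finset.univ.filter fun n : G => f n = 1).card := by
  rw [fiber_eq_image hs q, Finset.card_image_of_injective _ (mul_right_injective (s q))]

/-- **Fibrewise summation**: `Σ_{x : f x ∈ A} F(f x) = |ker f| · Σ_{q ∈ A} F(q)`. [folklore] -/
theorem sum_filter_map_mem (hs : ∀ q, f (s q) = q) (A : Finset Q) (F : Q → ℤ) :
    ∑ x ∈ Finset.univ.filter (fun x : G => f x ∈ A), F (f x) =
      ((Finset.univ.filter fun n : G => f n = 1).card : ℤ) * ∑ q ∈ A, F q := by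
  have hset : (Finset.univ.filter fun x : G => f x ∈ A) = A.biUnion fun q => Finset.univ.filter fun x : G => f x = q := by
    ext x
    simp only [Finset.mem_filter, Finset.mem_univ, true_and, Finset.mem_biUnion]
    constructor
    · intro hx; exact ⟨f x, hx, rfl⟩
    · rintro ⟨q, hq, hx⟩; rwa [hx]
  rw [hset, Finset.sum_biUnion (fun q₁ _ q₂ _ hne => Finset.disjoint_filter.2 fun x _ h₁ h₂ => hne (h₁.symm.trans h₂)),
    Finset.mul_sum]
  refine Finset.sum_congr rfl fun q _ => ?_
  rw [Finset.sum_congr rfl (fun x (hx : x ∈ Finset.univ.filter fun x : G => f x = q) =>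
      show F (f x) = F q by rw [(Finset.mem_filter.1 hx).2]),
    Finset.sum_const, card_fiber_eq hs q, nsmul_eq_mul]

/-! ## §2 The lift -/

/-- Membership in the lifted set. [folklore] -/
theorem mem_liftQ_iff (c : G) (T₀ : Finset Q) (x : G) :
    x ∈ (Finset.univ.filter fun y : G => if f y ∈ T₀ then y = s (f y) else y ≠ c * s (f c * f y)) ↔
      (if f x ∈ T₀ then x = s (f x) else x ≠ c * s (f c * f x)) := by
  rw [Finset.mem_filter, and_iff_right (Finset.mem_univ x)]

/-- **The lifted set is a CM set for `c`** (`c² = 1`; the missing point over `c₀ q` is `c` times the chosen point over `q`).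
[cite: Shimura1998, §18.2 Lemma (i)] -/
theorem mem_liftQ_cm (c : G) (hcc : c * c = 1) (T₀ : Finset Q)
    (hcm : ∀ q : Q, q ∈ T₀ ↔ f c * q ∉ T₀) (x : G) :
    x ∈ (Finset.univ.filter fun y : G => if f y ∈ T₀ then y = s (f y) else y ≠ c * s (f c * f y)) ↔
      c * x ∉ (Finset.univ.filter fun y : G => if f y ∈ T₀ then y = s (f y) else y ≠ c * s (f c * f y)) := by
  have hcc' : f c * f c = 1 := by rw [← map_mul, hcc, map_one]
  rw [mem_liftQ_iff, mem_liftQ_iff, map_mul]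
  by_cases hx : f x ∈ T₀
  · have hcx : f c * f x ∉ T₀ := (hcm (f x)).1 hx
    rw [if_pos hx, if_neg hcx, ← mul_assoc, hcc', one_mul, not_not]
    constructor
    · intro h; rw [← h]
    · intro h; exact mul_left_cancel h
  · have hcx : f c * f x ∈ T₀ := not_not.1 fun h => hx ((hcm (f x)).2 h)
    rw [if_neg hx, if_pos hcx]
    exact not_congr ⟨fun h => by conv_lhs => rw [h]
                                 rw [← mul_assoc, hcc, one_mul],
      fun h => by rw [← h, ← mul_assoc, hcc, one_mul]⟩

/-- Points of the fibre over `q ∈ T₀`: `s(q) n ∈ S ↔ n = 1` (`n ∈ ker f`). [folklore] -/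
theorem section_mul_mem_liftQ_iff (hs : ∀ q, f (s q) = q) (c : G) (T₀ : Finset Q) {q : Q} (hq : q ∈ T₀) {n : G}
    (hn : f n = 1) :
    s q * n ∈ (Finset.univ.filter fun y : G => if f y ∈ T₀ then y = s (f y) else y ≠ c * s (f c * f y)) ↔ n = 1 := by
  have hf : f (s q * n) = q := by rw [map_mul, hs, hn, mul_one]
  rw [mem_liftQ_iff, hf, if_pos hq]
  exact ⟨fun h => mul_left_cancel (h.trans (mul_one _).symm), fun h => by rw [h, mul_one]⟩

/-- Points of the fibre over `q ∉ T₀`: `c s(c₀ q) n ∈ S ↔ n ≠ 1` (`n ∈ ker f`). [folklore] -/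
theorem excluded_mul_mem_liftQ_iff (hs : ∀ q, f (s q) = q) (c : G) (hcc : c * c = 1) (T₀ : Finset Q) {q : Q}
    (hq : q ∉ T₀) {n : G} (hn : f n = 1) :
    c * s (f c * q) * n ∈ (Finset.univ.filter fun y : G => if f y ∈ T₀ then y = s (f y) else y ≠ c * s (f c * f y)) ↔
      n ≠ 1 := by
  have hcc' : f c * f c = 1 := by rw [← map_mul, hcc, map_one]
  have hf : f (c * s (f c * q) * n) = q := by rw [map_mul, map_mul, hs, hn, mul_one, ← mul_assoc, hcc', one_mul]
  rw [mem_liftQ_iff, hf, if_neg hq]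
  exact not_congr ⟨fun h => mul_left_cancel (h.trans (mul_one _).symm), fun h => by rw [h, mul_one]⟩

/-- **The lifted set has trivial left stabiliser** (`|ker f| ≥ 3` through two distinct non-trivial `n₁, n₂ ∈ ker f`).
[cite: Shimura1998, §8.2 Prop. 26] -/
theorem liftQ_leftStabiliser (hs : ∀ q, f (s q) = q) {n₁ n₂ : G} (hn₁ : f n₁ = 1) (hn₂ : f n₂ = 1) (h₁ : n₁ ≠ 1)
    (h₂ : n₂ ≠ 1) (h₁₂ : n₁ ≠ n₂) (c : G) (hcc : c * c = 1) (T₀ : Finset Q) (hcm : ∀ q : Q, q ∈ T₀ ↔ f c * q ∉ T₀)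
    (hprim : ∀ v : Q, v ≠ 1 → ∃ w : Q, ¬ (w ∈ T₀ ↔ v * w ∈ T₀)) (v : G) (hv : v ≠ 1) :
    ∃ w : G, ¬ (w ∈ (Finset.univ.filter fun y : G => if f y ∈ T₀ then y = s (f y) else y ≠ c * s (f c * f y)) ↔
      v * w ∈ (Finset.univ.filter fun y : G => if f y ∈ T₀ then y = s (f y) else y ≠ c * s (f c * f y))) := by
  -- `T₀` is non-empty
  obtain ⟨q₀, hq₀⟩ : ∃ q₀, q₀ ∈ T₀ := by
    by_cases h : (1 : Q) ∈ T₀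
    · exact ⟨1, h⟩
    · exact ⟨f c * 1, not_not.1 fun h' => h ((hcm 1).2 h')⟩
  by_cases hfv : f v = 1
  · -- `v ∈ ker f ∖ 1` moves the single point `s(q₀)` of its fibre
    refine ⟨s q₀ * 1, ?_⟩
    rw [section_mul_mem_liftQ_iff hs c T₀ hq₀ (map_one f), ← mul_assoc,
      show v * s q₀ * 1 = s q₀ * ((s q₀)⁻¹ * v * s q₀) by group,
      section_mul_mem_liftQ_iff hs c T₀ hq₀ (by rw [map_mul, map_mul, map_inv, hfv, mul_one, inv_mul_cancel])]
    have : (s q₀)⁻¹ * v * s q₀ ≠ 1 := fun h => hv (by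
      have h' := congrArg (fun y => s q₀ * y * (s q₀)⁻¹) h
      simpa [mul_assoc] using h')
    tauto
  · obtain ⟨q, hq⟩ := hprim (f v) hfv
    by_cases hqT : q ∈ T₀
    · -- the fibre over `q` has `≥ 2` non-points, the fibre over `f(v) q ∉ T₀` only one
      have hvq : f v * q ∉ T₀ := fun h => hq (iff_of_true hqT h)
      have hw : ∀ n : G, f n = 1 → f (v * (s q * n)) = f v * q := fun n hn => by rw [map_mul, map_mul, hs, hn, mul_one]
      have key : ∀ n : G, f n = 1 → v * (s q * n) ≠ c * s (f c * (f v * q)) →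
          v * (s q * n) ∈ (Finset.univ.filter fun y : G => if f y ∈ T₀ then y = s (f y) else y ≠ c * s (f c * f y)) :=
        fun n hn hne => by rw [mem_liftQ_iff, hw n hn, if_neg hvq]; exact hne
      by_cases hne : v * (s q * n₁) = c * s (f c * (f v * q))
      · refine ⟨s q * n₂, fun h => ?_⟩
        have hmem := key n₂ hn₂ (fun h' => h₁₂ (mul_left_cancel (mul_left_cancel (hne.trans h'.symm))))
        exact h₂ ((section_mul_mem_liftQ_iff hs c T₀ hqT hn₂).1 (h.2 hmem))
      · refine ⟨s q * n₁, fun h => ?_⟩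
        exact h₁ ((section_mul_mem_liftQ_iff hs c T₀ hqT hn₁).1 (h.2 (key n₁ hn₁ hne)))
    · -- the fibre over `q ∉ T₀` has `≥ 2` points, the fibre over `f(v) q ∈ T₀` only one
      have hvq : f v * q ∈ T₀ := not_not.1 fun h => hq (iff_of_false hqT h)
      have hcc' : f c * f c = 1 := by rw [← map_mul, hcc, map_one]
      have hw : ∀ n : G, f n = 1 → f (v * (c * s (f c * q) * n)) = f v * q := fun n hn => by
        rw [map_mul, map_mul, map_mul, hs, hn, mul_one, ← mul_assoc (f c), hcc', one_mul]
      have key : ∀ n : G, f n = 1 → v * (c * s (f c * q) * n) ≠ s (f v * q) →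
          v * (c * s (f c * q) * n) ∉ (Finset.univ.filter fun y : G => if f y ∈ T₀ then y = s (f y) else y ≠ c * s (f c * f y)) :=
        fun n hn hne => by rw [mem_liftQ_iff, hw n hn, if_pos hvq]; exact hne
      by_cases hne : v * (c * s (f c * q) * n₁) = s (f v * q)
      · refine ⟨c * s (f c * q) * n₂, fun h => ?_⟩
        have hnot := key n₂ hn₂ (fun h' => h₁₂ (mul_left_cancel (mul_left_cancel (hne.trans h'.symm))))
        exact hnot (h.1 ((excluded_mul_mem_liftQ_iff hs c hcc T₀ hqT hn₂).2 h₂))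
      · refine ⟨c * s (f c * q) * n₁, fun h => ?_⟩
        exact key n₁ hn₁ hne (h.1 ((excluded_mul_mem_liftQ_iff hs c hcc T₀ hqT hn₁).2 h₁))

/-- **The pulled-back weight `b₀ ∘ f` is annihilated by every right translate of the lifted set**: by fibres,
`Σ_{x ∈ S} b₀(f x · r) = Σ_{q ∈ T₀} b₀(q r) + (|ker f| − 1)·Σ_{q ∉ T₀} b₀(q r) = 0`. [cite: Kubota1965, §2] -/
theorem liftQ_annihilated [Fintype Q] (hs : ∀ q, f (s q) = q) (c : G) (hcc : c * c = 1) (T₀ : Finset Q)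
    (hcm : ∀ q : Q, q ∈ T₀ ↔ f c * q ∉ T₀) (b₀ : Q → ℤ) (hanti : ∀ q, b₀ (f c * q) = -b₀ q)
    (hann : ∀ g : Q, ∑ q ∈ T₀, b₀ (q * g) = 0) (g : G) :
    ∑ x ∈ (Finset.univ.filter fun y : G => if f y ∈ T₀ then y = s (f y) else y ≠ c * s (f c * f y)), b₀ (f (x * g)) = 0 := by
  classical
  have hcc' : f c * f c = 1 := by rw [← map_mul, hcc, map_one]
  set S := (Finset.univ.filter fun y : G => if f y ∈ T₀ then y = s (f y) else y ≠ c * s (f c * f y)) with hS_def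
  have hmem : ∀ x, x ∈ S ↔ (if f x ∈ T₀ then x = s (f x) else x ≠ c * s (f c * f x)) := mem_liftQ_iff c T₀
  simp only [map_mul]
  rw [← Finset.sum_filter_add_sum_filter_not S (fun x => f x ∈ T₀)]
  -- the points over `T₀`: the section
  have hS₁ : S.filter (fun x => f x ∈ T₀) = T₀.image s := by
    ext x
    simp only [Finset.mem_filter, Finset.mem_image, hmem]
    constructor
    · rintro ⟨h, hx⟩
      rw [if_pos hx] at h
      exact ⟨f x, hx, h.symm⟩
    · rintro ⟨q, hq, rfl⟩
      rw [hs, if_pos hq]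
      exact ⟨rfl, hq⟩
  have hsum₁ : ∑ x ∈ S.filter (fun x => f x ∈ T₀), b₀ (f x * f g) = 0 := by
    rw [hS₁, Finset.sum_image (fun q₁ _ q₂ _ h => by simpa [hs] using congrArg f h)]
    simp only [hs]
    exact hann (f g)
  -- the points over `Q ∖ T₀`: full fibres minus `c · s(T₀)`
  have hsub : T₀.image (fun q => c * s q) ⊆ Finset.univ.filter (fun x : G => f x ∈ Finset.univ.filter fun q => q ∉ T₀) := by
    intro x hx
    obtain ⟨q, hq, rfl⟩ := Finset.mem_image.1 hx
    simp only [Finset.mem_filter, Finset.mem_univ, true_and, map_mul, hs]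
    exact (hcm q).1 hq
  have hS₂ : S.filter (fun x => ¬ f x ∈ T₀) =
      (Finset.univ.filter fun x : G => f x ∈ Finset.univ.filter fun q => q ∉ T₀) \ T₀.image (fun q => c * s q) := by
    ext x
    simp only [Finset.mem_filter, Finset.mem_sdiff, Finset.mem_univ, true_and, Finset.mem_image, hmem, not_exists,
      not_and]
    constructor
    · rintro ⟨h, hx⟩
      rw [if_neg hx] at h
      refine ⟨hx, fun q hq hqx => h ?_⟩
      rw [← hqx, map_mul, hs, ← mul_assoc, hcc', one_mul]
    · rintro ⟨hx, h⟩
      rw [if_neg hx]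
      refine ⟨fun hx' => h (f c * f x) (not_not.1 fun h' => hx ((hcm (f x)).2 h')) hx'.symm, hx⟩
  have hsumU : ∑ x ∈ Finset.univ.filter (fun x : G => f x ∈ Finset.univ.filter fun q => q ∉ T₀), b₀ (f x * f g) = 0 := by
    rw [sum_filter_map_mem hs (Finset.univ.filter fun q => q ∉ T₀) (fun q => b₀ (q * f g))]
    have hsplit := Finset.sum_filter_add_sum_filter_not Finset.univ (fun q : Q => q ∈ T₀) (fun q => b₀ (q * f g))
    rw [sum_eq_zero_of_antisymm (f c) b₀ hanti (f g)] at hsplit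
    have hT : (Finset.univ.filter fun q : Q => q ∈ T₀) = T₀ := by ext q; simp
    rw [hT, hann (f g), zero_add] at hsplit
    rw [hsplit, mul_zero]
  have hsumV : ∑ x ∈ T₀.image (fun q => c * s q), b₀ (f x * f g) = 0 := by
    rw [Finset.sum_image (fun q₁ _ q₂ _ h => by simpa [hs] using congrArg f (mul_left_cancel h))]
    simp only [map_mul, hs, mul_assoc, hanti, Finset.sum_neg_distrib, neg_eq_zero]
    simpa only [mul_assoc] using hann (f g)
  have hsum₂ : ∑ x ∈ S.filter (fun x => ¬ f x ∈ T₀), b₀ (f x * f g) = 0 := by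
    rw [hS₂, Finset.sum_sdiff_eq_sub hsub, hsumU, hsumV, sub_zero]
  rw [hsum₁, hsum₂, add_zero]

/-- **THE LIFT OF A CERTIFICATE TO AN ARBITRARY EXTENSION WITH KERNEL OF ORDER `≥ 3`.**  `f : G →* Q` surjective, two distinct
non-trivial elements of `ker f`, `c ∈ G` with `c² = 1`, and an annihilator certificate `(T₀, b₀)` for `(Q, f c)` ⟹ an
annihilator certificate `(S, b₀ ∘ f)` for `(G, c)`. [cite: Kubota1965, §2] [cite: Shimura1998, §8.2 Prop. 26] -/
theorem exists_liftQ_certificate [Fintype Q] (hf : Function.Surjective f) {n₁ n₂ : G} (hn₁ : f n₁ = 1) (hn₂ : f n₂ = 1)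
    (h₁ : n₁ ≠ 1) (h₂ : n₂ ≠ 1) (h₁₂ : n₁ ≠ n₂) (c : G) (hcc : c * c = 1) (T₀ : Finset Q)
    (hcm : ∀ q : Q, q ∈ T₀ ↔ f c * q ∉ T₀) (hprim : ∀ v : Q, v ≠ 1 → ∃ w : Q, ¬ (w ∈ T₀ ↔ v * w ∈ T₀)) (b₀ : Q → ℤ)
    (hanti : ∀ q, b₀ (f c * q) = -b₀ q) (hann : ∀ g : Q, ∑ q ∈ T₀, b₀ (q * g) = 0) (hb : ∃ q, b₀ q ≠ 0) :
    ∃ (S : Finset G) (b : G → ℤ), (∀ x : G, x ∈ S ↔ c * x ∉ S) ∧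
      (∀ v : G, v ≠ 1 → ∃ w : G, ¬ (w ∈ S ↔ v * w ∈ S)) ∧ (∀ x, b (c * x) = -b x) ∧
      (∀ g : G, ∑ x ∈ S, b (x * g) = 0) ∧ ∃ x, b x ≠ 0 := by
  -- a set-theoretic section
  have hs : ∀ q, f (Function.surjInv hf q) = q := Function.surjInv_eq hf
  obtain ⟨q₀, hq₀⟩ := hb
  exact ⟨Finset.univ.filter fun y : G => if f y ∈ T₀ then y = Function.surjInv hf (f y) else
      y ≠ c * Function.surjInv hf (f c * f y),
    fun x => b₀ (f x), mem_liftQ_cm c hcc T₀ hcm, liftQ_leftStabiliser hs hn₁ hn₂ h₁ h₂ h₁₂ c hcc T₀ hcm hprim,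
    fun x => by show b₀ (f (c * x)) = -b₀ (f x); rw [map_mul, hanti], liftQ_annihilated hs c hcc T₀ hcm b₀ hanti hann,
    ⟨Function.surjInv hf q₀, by show b₀ (f (Function.surjInv hf q₀)) ≠ 0; rwa [hs]⟩⟩

end Model

end QuotientLift

/-! ## §3 The theorem for Galois CM fields -/

section Field

variable {K : Type} [Field K] [NumberField K] [IsCMField K] [IsGalois ℚ K]

/-- **A CERTIFIED-BAD QUOTIENT OF INDEX-KERNEL `≥ 3` MAKES THE FIELD BAD — no splitting needed.**  `e : Gal(K/ℚ) ≃* G₀`,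
`f : G₀ →* Q₀` surjective with two distinct non-trivial kernel elements (`|ker f| ≥ 3`), and an annihilator certificate
`(T₀, b₀)` for `(Q₀, f (e c))` ⟹ `K` carries a SIMPLE DEGENERATE abelian variety of dimension `|G₀|/2` with CM by `K`
(rational `(p,p)` class outside the divisor ring on some power). [cite: Kubota1965, §2 and §4 Lemma 2]
[cite: Shimura1998, §6.2 Thm. 3 and §8.2 Prop. 26] [cite: Gordon1999HodgeAVSurvey, Thm. 6.4 and §9.3] -/
theorem exists_simple_degenerate_of_quotient_certificate {G₀ Q₀ : Type*} [Group G₀] [Fintype G₀] [DecidableEq G₀]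
    [Group Q₀] [Fintype Q₀] [DecidableEq Q₀] (e : (K ≃ₐ[ℚ] K) ≃* G₀) (f : G₀ →* Q₀) (hf : Function.Surjective f)
    {n₁ n₂ : G₀} (hn₁ : f n₁ = 1) (hn₂ : f n₂ = 1) (h₁ : n₁ ≠ 1) (h₂ : n₂ ≠ 1) (h₁₂ : n₁ ≠ n₂) (c₀ : Q₀)
    (hc : f (e ((IsCMField.complexConj K).restrictScalars ℚ)) = c₀) (T₀ : Finset Q₀)
    (hcm : ∀ q : Q₀, q ∈ T₀ ↔ c₀ * q ∉ T₀) (hprim : ∀ v : Q₀, v ≠ 1 → ∃ w : Q₀, ¬ (w ∈ T₀ ↔ v * w ∈ T₀))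
    (b₀ : Q₀ → ℤ) (hanti : ∀ q, b₀ (c₀ * q) = -b₀ q) (hann : ∀ g : Q₀, ∑ q ∈ T₀, b₀ (q * g) = 0)
    (hb : ∃ q, b₀ q ≠ 0) :
    ∃ (Φ : CMType K) (φ₀ : K →+* ℂ) (X : AbelianVariety ℂ) (ι : 𝓞 K →+* End X)
      (ϑ : K →+* Module.End ℂ (complexBetti X.X 1)),
      IsPrimitive (ℂ ≃+* ℂ) Φ.1 φ₀ ∧ ¬ IsNondegenerate Φ ∧ IsCMTypeRealisation Φ X ι ϑ ∧ X.IsSimple ∧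
      X.dim = Fintype.card G₀ / 2 ∧
      ∃ m p : ℕ, ∃ y : complexBetti (⨁ fun _ : Fin m => X).X (2 * p), IsRationalClass y ∧
        IsOfHodgeType (⨁ fun _ : Fin m => X).dim (⨁ fun _ : Fin m => X).X (2 * p) p p y ∧
        y ∉ divisorClassesSpan (⨁ fun _ : Fin m => X).X (⨁ fun _ : Fin m => X).dim p := by
  subst hc
  obtain ⟨S, b, hcm', hprim', hanti', hann', hb'⟩ :=
    QuotientLift.exists_liftQ_certificate hf hn₁ hn₂ h₁ h₂ h₁₂ (e ((IsCMField.complexConj K).restrictScalars ℚ))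
      (GaloisRank.model_complexConj_mul_self e rfl) T₀ hcm hprim b₀ hanti hann hb
  exact exists_simple_degenerate_of_model_annihilator e _ rfl S hcm' hprim' b hanti' hann' hb'

end Field

end Summit.HodgeConjecture.CorCM.GaloisModels

end
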